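/-
Copyright (c) 2026 the pub-hodgecm-mathlib formalisation cell (harness21).  Prover seat hodgecm-mathlib-F0P3a-p03 (g21), 2026-09-02 (LH7 leaf ED. 3 road,
print organ O8a `PKsaU2Shape`, steps (3)+(4): the Kneser step for `U(antidiag(1,1))` with every socket plugged, in the `S₁` letter of the
consumer, and its CM dresses).
-/
import Literature.NumberTheory.Automorphic.UnitaryGroupAdelicNormOneSockets
import Literature.NumberTheory.Automorphic.UnitaryGroupFiniteAdelicDenseOrbitCM
import HarnessLib

/-!
# The Kneser step for `U(antidiag(1,1))`, plugged: one local `SU` fixing `P` ⇒ `SU(𝔸)` fixes `P` ⇒ `P` is a character twist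

Topic `NumberTheory/Automorphic`; THEOREMS ONLY (no definition, no instance, no named fact, no notation, no `sorry`).

Sequel of ★ `UnitaryGroupAdelicNormOneSockets` (§6 there takes the local fixing hypothesis through a finite component `σ ↪ P.finRep`);
here the SAME two heads in the `S₁` letter of ★ `AutomorphicKneserCharacter` ∕ ★ `F0P3cPKtupleSaU2LocalFix`
(`hfix : ∀ s ∈ inclPlaceAdelic v₁ '' {u | ∀ w, det u_w = 1}, ∀ f, P.space.toContRep s f = f`), with the auxiliary place `w₁ ∣ v₁` chosen
inside, and their CM dresses with weak approximation at `∞` DISCHARGED (★ `denseRange_archPart_toAdelic_antidiagOne`):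

* `toContRep_apply_eq_self_of_det_eq_one_of_forall_mem_image` — `det s = 1 ⇒ R(s)` fixes `P` (generic `F E c`, `hJ2 : J = !![0,1;1,0]`);
* `exists_eq_ofChar_of_forall_mem_image_inclPlaceAdelic_apply_eq_self` — `∃ ψ, P = ofChar ψ μ` (generic, under `hWA`);
* `cm_toContRep_apply_eq_self_of_det_eq_one_of_forall_mem_image`, **`cm_exists_eq_ofChar_of_forall_mem_image_inclPlaceAdelic_apply_eq_self`**
  (`F = L⁺`, `E = L`, `c` = complex conjugation, `J = Φ₂` in the H413 literal spelling; binder-free but for `P` and `hfix`).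

CONSUMER (cell `hodgecm-mathlib`, crux H413 = stmt-HodgeConjecture-24833, O8a `PKsaU2Shape` assembly (6), `Theorems/F0P3cPKtupleSaU2.lean`):
`obtain ⟨ψ, hψ⟩ := cm_exists_eq_ofChar_of_forall_mem_image_inclPlaceAdelic_apply_eq_self L P
(F0P3cPKtupleSaU2LocalFix.forall_mem_image_inclPlaceAdelic_apply_eq_self_of_eq_mk_ofChar π₂ P σ hirr hsm ι hι v₁ hconst χ' hχ' hv)`, then ★
`UnitaryGroupDetCharacterSection.cm_exists_eq_cmDetChar_antidiagOne_two` and ★ `F0P3cPKtupleSaU2LocalClasses`.  HONEST LABEL: plumbing over ★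
bricks; HC_CM is proved only modulo the printed citations of that programme until its rung 0 closes.

References: [PlatonovRapinchuk1994] §7.1 Thm. 7.7 (weak approximation), §7.3 Prop. 7.8, §7.4 Thm. 7.12 and proof of Prop. 7.13 (strong
approximation, Kneser's argument); [Kneser1966]; [BorelJacquet1979] §4.6.
-/

set_option autoImplicit false

noncomputable section

open NumberField IsDedekindDomain Topology Set

namespace Literature.NumberTheory.Automorphic

namespace UnitaryGroup

variable (F E : Type) [Field F] [NumberField F] [Field E] [NumberField E] [Algebra F E]
  (c : E ≃ₐ[F] E)

/-! ## The `S₁`-form plugs (the `hfix` letter of ★ `AutomorphicKneserCharacter` ∕ ★ `F0P3cPKtupleSaU2LocalFix`), `w₁`-free, and their CM dresses -/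

/-- **`SU(J)(𝔸_F)` fixes `P`, `S₁`-form** (`J ≃ antidiag(1,1)`, `E/F` quadratic Galois, `c ≠ 1`): if every element of
`S₁ := ι_{v₁}(SU(J)(F_{v₁}))` fixes every vector of `P`, so does every `s ∈ U(J)(𝔸_F)` with `det s = 1` (§6 with the place `w₁ ∣ v₁` chosen
inside). [cite: PlatonovRapinchuk1994, §7.4 Thm. 7.12 and Prop. 7.13 (proof)] [cite: BorelJacquet1979, §4.6] -/
theorem toContRep_apply_eq_self_of_det_eq_one_of_forall_mem_image [Algebra.IsQuadraticExtension F E] [IsGalois F E] (hc : c ≠ 1)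
    {J : Matrix (Fin 2) (Fin 2) E} (hJ2 : J = !![0, 1; 1, 0])
    {μ : MeasureTheory.Measure (adelicGroupData F E c 2 J).automorphicQuotient} [(adelicGroupData F E c 2 J).IsAutomorphicMeasure μ]
    (P : DiscreteAutomorphicRep (adelicGroupData F E c 2 J) μ) {v₁ : HeightOneSpectrum (𝓞 F)}
    (hfix : ∀ s ∈ inclPlaceAdelic F E c 2 J v₁ '' {u : ↥(localPi E c 2 J v₁) | ∀ w : PlacesOver E v₁,
      (((u : LocalGLPi E 2 v₁) w : GL (Fin 2) (w.1.adicCompletion E)) : Matrix (Fin 2) (Fin 2) (w.1.adicCompletion E)).det = 1},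
      ∀ f : ↥P.space.toSubmodule, P.space.toContRep s f = f)
    (s : ↥(adelic F E c 2 J)) (hs : ((s : GL (Fin 2) (AdeleRing (𝓞 E) E)) : Matrix (Fin 2) (Fin 2) (AdeleRing (𝓞 E) E)).det = 1)
    (f : ↥P.space.toSubmodule) : P.space.toContRep s f = f := by
  haveI : LocallyCompactSpace (adelicGroupData F E c 2 J).Adelic := inferInstanceAs (LocallyCompactSpace (adelic F E c 2 J))
  haveI : SecondCountableTopology (adelicGroupData F E c 2 J).Adelic := inferInstanceAs (SecondCountableTopology (adelic F E c 2 J))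
  obtain ⟨w₁⟩ : Nonempty (PlacesOver E v₁) := inferInstance
  obtain ⟨N₀, hN₀n, hN₀c, hN₀⟩ := exists_subgroup_normal_isClosed_coe_eq_setOf_det_eq_one F E c 2 J
  haveI := hN₀n
  have hn : s ∈ (N₀ : Set (adelicGroupData F E c 2 J).Adelic) := by rw [hN₀]; exact hs
  exact P.toContRep_apply_eq_self_of_subset_closure μ N₀ hN₀c _ (toAdelic_image_subset_quotientSubgroup F E c 2 J _)
    (coe_subset_closure_of_coe_eq F E c hc hJ2 w₁ hN₀) hfix hn f

/-- **`P` is a character twist, `S₁`-form** (`J ≃ antidiag(1,1)`, `E/F` quadratic Galois, `c ≠ 1`, weak approximation `hWA` at `∞`): if every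
element of `S₁ := ι_{v₁}(SU(J)(F_{v₁}))` fixes every vector of `P`, then `P = ofChar ψ μ` for an automorphic character `ψ` — ★
`UnitaryGroup.exists_eq_ofChar_of_subset_closure_of_commutator_mem` with `N₀`, `D`, density and `hcomm` plugged (§1, §3, §5).
[cite: PlatonovRapinchuk1994, §7.3 Prop. 7.8, §7.4 Thm. 7.12] [cite: BorelJacquet1979, §4.6] -/
theorem exists_eq_ofChar_of_forall_mem_image_inclPlaceAdelic_apply_eq_self [Algebra.IsQuadraticExtension F E] [IsGalois F E]
    (hc : c ≠ 1) {J : Matrix (Fin 2) (Fin 2) E} (hJ2 : J = !![0, 1; 1, 0])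
    {μ : MeasureTheory.Measure (adelicGroupData F E c 2 J).automorphicQuotient} [(adelicGroupData F E c 2 J).IsAutomorphicMeasure μ]
    (hWA : DenseRange fun γ : (adelicGroupData F E c 2 J).Rational =>
      archPart F E c 2 J ((adelicGroupData F E c 2 J).toAdelic γ))
    (P : DiscreteAutomorphicRep (adelicGroupData F E c 2 J) μ) {v₁ : HeightOneSpectrum (𝓞 F)}
    (hfix : ∀ s ∈ inclPlaceAdelic F E c 2 J v₁ '' {u : ↥(localPi E c 2 J v₁) | ∀ w : PlacesOver E v₁,
      (((u : LocalGLPi E 2 v₁) w : GL (Fin 2) (w.1.adicCompletion E)) : Matrix (Fin 2) (Fin 2) (w.1.adicCompletion E)).det = 1},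
      ∀ f : ↥P.space.toSubmodule, P.space.toContRep s f = f) :
    ∃ ψ : (adelicGroupData F E c 2 J).AutomorphicCharacter, P = DiscreteAutomorphicRep.ofChar ψ μ := by
  haveI : LocallyCompactSpace (adelicGroupData F E c 2 J).Adelic := inferInstanceAs (LocallyCompactSpace (adelic F E c 2 J))
  haveI : SecondCountableTopology (adelicGroupData F E c 2 J).Adelic := inferInstanceAs (SecondCountableTopology (adelic F E c 2 J))
  obtain ⟨w₁⟩ : Nonempty (PlacesOver E v₁) := inferInstance
  obtain ⟨N₀, hN₀n, hN₀c, hN₀⟩ := exists_subgroup_normal_isClosed_coe_eq_setOf_det_eq_one F E c 2 J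
  haveI := hN₀n
  have hcomm : ∀ (b : finAdelic F E c 2 J) (g : (adelicGroupData F E c 2 J).Adelic),
      g⁻¹ * (finAdelicToAdelic F E c 2 J b)⁻¹ * g * finAdelicToAdelic F E c 2 J b ∈ N₀ := fun b g => by
    have h : g⁻¹ * (finAdelicToAdelic F E c 2 J b)⁻¹ * g * finAdelicToAdelic F E c 2 J b ∈
        (N₀ : Set (adelicGroupData F E c 2 J).Adelic) := by
      rw [hN₀]
      exact det_coe_inv_mul_inv_mul_mul F E c 2 J g (finAdelicToAdelic F E c 2 J b)
    exact h
  exact exists_eq_ofChar_of_subset_closure_of_commutator_mem F E c 2 J μ hWA P N₀ hN₀c _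
    (toAdelic_image_subset_quotientSubgroup F E c 2 J _) (coe_subset_closure_of_coe_eq F E c hc hJ2 w₁ hN₀) hfix hcomm

/-- **CM dress, `S₁`-form: `SU(Φ₂)(𝔸_{L⁺})` fixes `P`** (`F = L⁺`, `E = L`, `c` = complex conjugation, `J = Φ₂` in the H413 literal spelling;
`c ≠ 1`, `IsQuadraticExtension`, `IsGalois` discharged). [cite: PlatonovRapinchuk1994, §7.4 Thm. 7.12 and Prop. 7.13 (proof)] [cite: BorelJacquet1979, §4.6] -/
theorem cm_toContRep_apply_eq_self_of_det_eq_one_of_forall_mem_image (L : Type) [Field L] [NumberField L] [IsCMField L]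
    {μ : MeasureTheory.Measure (adelicGroupData ↥(maximalRealSubfield L) L (IsCMField.complexConj L) 2
      (Matrix.of fun i j : Fin 2 => if i.val + j.val + 1 = 2 then (1 : L) else 0)).automorphicQuotient} [(adelicGroupData ↥(maximalRealSubfield L) L (IsCMField.complexConj L) 2
      (Matrix.of fun i j : Fin 2 => if i.val + j.val + 1 = 2 then (1 : L) else 0)).IsAutomorphicMeasure μ]
    (P : DiscreteAutomorphicRep (adelicGroupData ↥(maximalRealSubfield L) L (IsCMField.complexConj L) 2
      (Matrix.of fun i j : Fin 2 => if i.val + j.val + 1 = 2 then (1 : L) else 0)) μ) {v₁ : HeightOneSpectrum (𝓞 ↥(maximalRealSubfield L))}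
    (hfix : ∀ s ∈ inclPlaceAdelic ↥(maximalRealSubfield L) L (IsCMField.complexConj L) 2 (Matrix.of fun i j : Fin 2 => if i.val + j.val + 1 = 2 then (1 : L) else 0) v₁ ''
      {u : ↥(localPi L (IsCMField.complexConj L) 2 (Matrix.of fun i j : Fin 2 => if i.val + j.val + 1 = 2 then (1 : L) else 0) v₁) | ∀ w : PlacesOver L v₁,
        (((u : LocalGLPi L 2 v₁) w : GL (Fin 2) (w.1.adicCompletion L)) : Matrix (Fin 2) (Fin 2) (w.1.adicCompletion L)).det = 1},
      ∀ f : ↥P.space.toSubmodule, P.space.toContRep s f = f)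
    (s : ↥(adelic ↥(maximalRealSubfield L) L (IsCMField.complexConj L) 2 (Matrix.of fun i j : Fin 2 => if i.val + j.val + 1 = 2 then (1 : L) else 0)))
    (hs : ((s : GL (Fin 2) (AdeleRing (𝓞 L) L)) : Matrix (Fin 2) (Fin 2) (AdeleRing (𝓞 L) L)).det = 1)
    (f : ↥P.space.toSubmodule) : P.space.toContRep s f = f := by
  haveI : Algebra.IsQuadraticExtension ↥(maximalRealSubfield L) L := IsCMField.isQuadraticExtension L
  exact toContRep_apply_eq_self_of_det_eq_one_of_forall_mem_image ↥(maximalRealSubfield L) L (IsCMField.complexConj L) (IsCMField.complexConj_ne_one L)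
    (by ext i j; fin_cases i <;> fin_cases j <;> rfl) P hfix s hs f

/-- **CM dress, `S₁`-form: `P` is a character twist** (`F = L⁺`, `E = L`, `c` = complex conjugation, `J = Φ₂` in the H413 literal spelling; weak
approximation at `∞` discharged by ★ `denseRange_archPart_toAdelic_antidiagOne`): if `ι_{v₁}(SU(Φ₂)(L⁺_{v₁}))` fixes every vector of the
discrete automorphic `P` of `U(Φ₂)`, then `P = ofChar ψ μ` for an automorphic character `ψ` of `U(Φ₂)(𝔸_{L⁺})` — the O8a step (3)+(4)+(5a) head for
the `PKsaU2Shape` assembly (feed `hfix` := ★ `F0P3cPKtupleSaU2LocalFix.forall_mem_image_inclPlaceAdelic_apply_eq_self_of_eq_mk_ofChar`, then ★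
`UnitaryGroupDetCharacterSection` and ★ `F0P3cPKtupleSaU2LocalClasses`). [cite: PlatonovRapinchuk1994, §7.1 Thm. 7.7, §7.4 Thm. 7.12] [cite: BorelJacquet1979, §4.6] -/
theorem cm_exists_eq_ofChar_of_forall_mem_image_inclPlaceAdelic_apply_eq_self (L : Type) [Field L] [NumberField L] [IsCMField L]
    {μ : MeasureTheory.Measure (adelicGroupData ↥(maximalRealSubfield L) L (IsCMField.complexConj L) 2
      (Matrix.of fun i j : Fin 2 => if i.val + j.val + 1 = 2 then (1 : L) else 0)).automorphicQuotient} [(adelicGroupData ↥(maximalRealSubfield L) L (IsCMField.complexConj L) 2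
      (Matrix.of fun i j : Fin 2 => if i.val + j.val + 1 = 2 then (1 : L) else 0)).IsAutomorphicMeasure μ]
    (P : DiscreteAutomorphicRep (adelicGroupData ↥(maximalRealSubfield L) L (IsCMField.complexConj L) 2
      (Matrix.of fun i j : Fin 2 => if i.val + j.val + 1 = 2 then (1 : L) else 0)) μ) {v₁ : HeightOneSpectrum (𝓞 ↥(maximalRealSubfield L))}
    (hfix : ∀ s ∈ inclPlaceAdelic ↥(maximalRealSubfield L) L (IsCMField.complexConj L) 2 (Matrix.of fun i j : Fin 2 => if i.val + j.val + 1 = 2 then (1 : L) else 0) v₁ ''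
      {u : ↥(localPi L (IsCMField.complexConj L) 2 (Matrix.of fun i j : Fin 2 => if i.val + j.val + 1 = 2 then (1 : L) else 0) v₁) | ∀ w : PlacesOver L v₁,
        (((u : LocalGLPi L 2 v₁) w : GL (Fin 2) (w.1.adicCompletion L)) : Matrix (Fin 2) (Fin 2) (w.1.adicCompletion L)).det = 1},
      ∀ f : ↥P.space.toSubmodule, P.space.toContRep s f = f) :
    ∃ ψ : (adelicGroupData ↥(maximalRealSubfield L) L (IsCMField.complexConj L) 2
      (Matrix.of fun i j : Fin 2 => if i.val + j.val + 1 = 2 then (1 : L) else 0)).AutomorphicCharacter, P = DiscreteAutomorphicRep.ofChar ψ μ := by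
  haveI : Algebra.IsQuadraticExtension ↥(maximalRealSubfield L) L := IsCMField.isQuadraticExtension L
  exact exists_eq_ofChar_of_forall_mem_image_inclPlaceAdelic_apply_eq_self ↥(maximalRealSubfield L) L (IsCMField.complexConj L) (IsCMField.complexConj_ne_one L)
    (by ext i j; fin_cases i <;> fin_cases j <;> rfl) (denseRange_archPart_toAdelic_antidiagOne L 2) P hfix

end UnitaryGroup

end Literature.NumberTheory.Automorphic

end
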